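import Literature.NumberTheory.EllipticCurves.HeegnerPointsImaginaryQuadraticProofs
import Literature.NumberTheory.QuadraticFields.HeegnerCondition
import Literature.NumberTheory.GaloisRepresentations.SGeneralQuadraticFamily
import Mathlib.Data.Rat.Sqrt
import HarnessLib

set_option linter.dupNamespace false
set_option autoImplicit false

/-!
# LINE B49, genus assembly — squares in the genus field `H₀ = K(i)` of `K = ℚ(√−q)`

Cell `bsd-goldfeld`, seat `bsd-goldfeld-s1p-c3` (prover, gen 6); TARGET v5.2 §2 c3 (e) GENUS ASSEMBLY, the
field-theoretic input of the kernel genus descent (`…TwinGenusOddMultiple.lean`). Support for item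
`stmt-BirchSwinnertonDyer-19140` (crux twin″ `Theses.GoldfeldAllTwistsTwoConverse.BSDTwoCMSevenAdditiveRankOne`,
joint with 20044) of `route-BirchSwinnertonDyer-GoldfeldAllTwistsTwoConverse`. HONEST FRAMING: pure algebra;
nothing about BSD is proved or asserted here. Everything is PROVED; no definition, no named fact. Not in the
Theses import cone (ruling (xii)).

* §1 `isSquare_or_isSquare_mul_of_isSquare_algebraMap` — in a quadratic extension `L = K ⊕ Kθ`, `θ² = D`,
  `θ ∉ K`, `2 ≠ 0`: `c ∈ K` a square in `L` ⟹ `c` or `c·D` is a square in `K`;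
  `exists_eq_add_mul_of_finrank_eq_two` — `[L : K] = 2`, `θ ∉ K` ⟹ `L = K ⊕ Kθ`.
* §2 rational bookkeeping: negative rationals, primes and `14·q` are not squares (`p·r` for primes `p ≠ r`:
  the tree's `QuadraticFamily.not_isSquare_mul_of_prime`);
  `not_isSquare_genusConstants` — for a prime `q ≠ 2, 7` none of `c`, `c·(−4q)`, `c ∈ {±7, ±2, ±14}`, is a
  rational square.
* §3 `exists_sq_eq_discr_and_span` (`K = ℚ ⊕ ℚ√d_K` for `K` imaginary quadratic, from the tree's
  `QuadraticFields.Quadratic.exists_sq_eq_discr`), `isSquare_or_of_isSquare_algebraMap_rat`,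
  `isSquare_or_of_isSquare_algebraMap_genusField` and **`not_isSquare_genusField`**: for `K` imaginary
  quadratic with `d_K = −4q` (`q` prime, `q ≠ 2, 7`) and a quadratic extension `H₀/K` containing `i₀`,
  `i₀² = −1` (the genus field `K(i) = ℚ(i, √q)`): **`−7, 7, −2, −14` are not squares in `H₀`** — the four
  constants of the `2`-isogeny descent on `X₀(49)` (`a² − 4b = −7`, `b = 4²·7`, `α((0,i)) = [−2]`,
  `α((0,i))·[b] = [−14]` on the normal form `y² = x³ + 21x² + 112x`).

References: D. A. Cox, *Primes of the form x² + ny²*, 2nd ed. (2013), §6.A (genus field) [Cox2013];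
J. H. Silverman, J. T. Tate, *Rational Points on Elliptic Curves*, 2nd ed. (2015), §3.5 [SilvermanTate2015].
-/

noncomputable section

open scoped Classical

open Literature.NumberTheory.EllipticCurves Literature.NumberTheory.GaloisRepresentations

namespace Summit.BirchSwinnertonDyer.BirchSwinnertonDyer.Theorems.GoldfeldGoodTwists

/-! ## §1 Squares in quadratic extensions -/

section QuadraticExtension

variable {K L : Type*} [Field K] [Field L] [Algebra K L]

/-- In a quadratic extension `L = K ⊕ K θ` with `θ² = D ∈ K`, `θ ∉ K` and `2 ≠ 0`: an element `c ∈ K`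
that becomes a square in `L` is a square in `K` or `c·D` is (from `(a + bθ)² = c`: `2ab = 0`).
[folklore] -/
theorem isSquare_or_isSquare_mul_of_isSquare_algebraMap (h2 : (2 : K) ≠ 0) {θ : L} {D : K}
    (hθ : θ ^ 2 = algebraMap K L D) (hθK : ∀ a : K, algebraMap K L a ≠ θ)
    (hspan : ∀ z : L, ∃ a b : K, z = algebraMap K L a + algebraMap K L b * θ)
    {c : K} (hc : IsSquare (algebraMap K L c)) : IsSquare c ∨ IsSquare (c * D) := by
  obtain ⟨z, hz⟩ := hc
  obtain ⟨a, b, rfl⟩ := hspan z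
  set φ := algebraMap K L with hφ
  have key : φ (c - a ^ 2 - b ^ 2 * D) = φ (2 * a * b) * θ := by
    simp only [map_sub, map_mul, map_pow, map_ofNat]
    linear_combination hz + (φ b) ^ 2 * hθ
  by_cases hab : 2 * a * b = 0
  · have hc' : c = a ^ 2 + b ^ 2 * D := by
      rw [hab, map_zero, zero_mul, map_eq_zero_iff φ φ.injective] at key
      linear_combination key
    rcases mul_eq_zero.mp hab with ha | hb
    · rcases mul_eq_zero.mp ha with h | h
      · exact absurd h h2
      · right; exact ⟨b * D, by rw [hc', h]; ring⟩
    · left; exact ⟨a, by rw [hc', hb]; ring⟩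
  · exfalso
    apply hθK ((c - a ^ 2 - b ^ 2 * D) / (2 * a * b))
    rw [map_div₀, key]
    exact mul_div_cancel_left₀ θ ((map_ne_zero φ).mpr hab)

/-- In an extension `L/K` of degree `2`, an element `θ ∉ K` gives the `K`-basis `(1, θ)`:
every `z ∈ L` is `a + bθ`. [folklore] -/
theorem exists_eq_add_mul_of_finrank_eq_two (h2 : Module.finrank K L = 2) {θ : L}
    (hθK : ∀ a : K, algebraMap K L a ≠ θ) (z : L) :
    ∃ a b : K, z = algebraMap K L a + algebraMap K L b * θ := by
  have hli : LinearIndependent K ![(1 : L), θ] := by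
    refine LinearIndependent.pair_iff.mpr fun s t hst => ?_
    by_cases ht : t = 0
    · subst ht
      rw [zero_smul, add_zero, smul_eq_zero] at hst
      exact ⟨hst.resolve_right one_ne_zero, rfl⟩
    · exfalso
      apply hθK (-s / t)
      rw [Algebra.smul_def, Algebra.smul_def, mul_one] at hst
      have htL : algebraMap K L t ≠ 0 := (map_ne_zero _).mpr ht
      rw [map_div₀, map_neg, div_eq_iff htL]
      linear_combination -hst
  let b := basisOfLinearIndependentOfCardEqFinrank hli (by rw [h2]; simp)
  refine ⟨b.repr z 0, b.repr z 1, ?_⟩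
  conv_lhs => rw [← b.sum_repr z]
  rw [Fin.sum_univ_two, coe_basisOfLinearIndependentOfCardEqFinrank]
  simp only [Matrix.cons_val_zero, Matrix.cons_val_one, Algebra.smul_def, mul_one]

end QuadraticExtension

/-! ## §2 Rational squares -/

/-- A negative rational is not a square. [folklore] -/
theorem not_isSquare_of_neg {x : ℚ} (hx : x < 0) : ¬ IsSquare x := fun ⟨r, hr⟩ => by
  nlinarith [mul_self_nonneg r]

/-- A prime is not a square. [folklore] -/
theorem not_isSquare_prime {p : ℕ} (hp : p.Prime) : ¬ IsSquare p := by
  rintro ⟨s, hs⟩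
  have hsp : s ∣ p := ⟨s, hs⟩
  rcases (Nat.dvd_prime hp).mp hsp with h | h
  · rw [h, mul_one] at hs; exact hp.one_lt.ne' hs
  · rw [h] at hs; nlinarith [hp.one_lt]

/-- `14·q` is not a square for a prime `q`. [folklore] -/
theorem not_isSquare_fourteen_mul_prime {q : ℕ} (hq : q.Prime) : ¬ IsSquare (14 * q) := by
  rintro ⟨s, hs⟩
  have hqs : q ∣ s := by
    have : q ∣ s * s := ⟨14, by rw [← hs]; ring⟩
    exact ((Nat.Prime.dvd_mul hq).mp this).elim id id
  obtain ⟨t, rfl⟩ := hqs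
  have h14 : 14 = q * (t * t) := by
    have : q * 14 = q * (q * (t * t)) := by linear_combination hs
    exact Nat.eq_of_mul_eq_mul_left hq.pos this
  have ht : t ≤ 2 := by nlinarith [hq.two_le]
  interval_cases t
  · omega
  · norm_num at h14
    rw [← h14] at hq
    norm_num at hq
  · omega

/-- From a square `4·x` to a square `x` in `ℚ`. [folklore] -/
theorem isSquare_of_isSquare_four_mul {x : ℚ} (h : IsSquare (4 * x)) : IsSquare x := by
  obtain ⟨r, hr⟩ := h
  exact ⟨r / 2, by linear_combination hr / 4⟩

/-- The rational bookkeeping of the genus descent at `d_K = −4q`: for a prime `q ≠ 2, 7` none of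
`±7, ±2, ±14, ±7·(−4q)⁻¹…` — precisely: `c` and `c·(−4q)` for `c ∈ {−7, 7, −2, 2, −14, 14}` — is a square
in `ℚ`. [folklore] -/
theorem not_isSquare_genusConstants {q : ℕ} (hq : q.Prime) (hq2 : q ≠ 2) (hq7 : q ≠ 7) :
    (¬ IsSquare (-7 : ℚ) ∧ ¬ IsSquare ((-7 : ℚ) * -(4 * q))) ∧
    (¬ IsSquare (7 : ℚ) ∧ ¬ IsSquare ((7 : ℚ) * -(4 * q))) ∧
    (¬ IsSquare (-2 : ℚ) ∧ ¬ IsSquare ((-2 : ℚ) * -(4 * q))) ∧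
    (¬ IsSquare (2 : ℚ) ∧ ¬ IsSquare ((2 : ℚ) * -(4 * q))) ∧
    (¬ IsSquare (-14 : ℚ) ∧ ¬ IsSquare ((-14 : ℚ) * -(4 * q))) ∧
    (¬ IsSquare (14 : ℚ) ∧ ¬ IsSquare ((14 : ℚ) * -(4 * q))) := by
  have hq0 : (0 : ℚ) < q := by exact_mod_cast hq.pos
  have n7 : ¬ IsSquare (7 : ℚ) := by
    rw [show (7 : ℚ) = ((7 : ℕ) : ℚ) by norm_num, Rat.isSquare_natCast_iff]
    exact not_isSquare_prime (by norm_num)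
  have n2 : ¬ IsSquare (2 : ℚ) := by
    rw [show (2 : ℚ) = ((2 : ℕ) : ℚ) by norm_num, Rat.isSquare_natCast_iff]
    exact not_isSquare_prime (by norm_num)
  have n14 : ¬ IsSquare (14 : ℚ) := by
    rw [show (14 : ℚ) = ((2 * 7 : ℕ) : ℚ) by norm_num, Rat.isSquare_natCast_iff]
    exact QuadraticFamily.not_isSquare_mul_of_prime (by norm_num) (by norm_num) (by norm_num)
  have n7q : ¬ IsSquare ((7 * q : ℕ) : ℚ) := by
    rw [Rat.isSquare_natCast_iff]
    exact QuadraticFamily.not_isSquare_mul_of_prime (by norm_num) hq (Ne.symm hq7)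
  have n2q : ¬ IsSquare ((2 * q : ℕ) : ℚ) := by
    rw [Rat.isSquare_natCast_iff]
    exact QuadraticFamily.not_isSquare_mul_of_prime (by norm_num) hq (Ne.symm hq2)
  have n14q : ¬ IsSquare ((14 * q : ℕ) : ℚ) := by
    rw [Rat.isSquare_natCast_iff]; exact not_isSquare_fourteen_mul_prime hq
  refine ⟨⟨not_isSquare_of_neg (by norm_num), fun h => n7q ?_⟩,
    ⟨n7, not_isSquare_of_neg (by nlinarith)⟩,
    ⟨not_isSquare_of_neg (by norm_num), fun h => n2q ?_⟩,
    ⟨n2, not_isSquare_of_neg (by nlinarith)⟩,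
    ⟨not_isSquare_of_neg (by norm_num), fun h => n14q ?_⟩,
    ⟨n14, not_isSquare_of_neg (by nlinarith)⟩⟩
  · push_cast; exact isSquare_of_isSquare_four_mul (by convert h using 1; ring)
  · push_cast; exact isSquare_of_isSquare_four_mul (by convert h using 1; ring)
  · push_cast; exact isSquare_of_isSquare_four_mul (by convert h using 1; ring)

/-! ## §3 The genus field `H₀ = K(i)` of `K = ℚ(√−q)`: the four non-squares -/

section GenusField

variable {K : Type} [Field K] [NumberField K]

/-- `K = ℚ(√d_K)`: an imaginary quadratic field contains a square root `δ` of its discriminant, not in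
`ℚ` (`d_K < 0`), and `K = ℚ ⊕ ℚδ`. [folklore] -/
theorem exists_sq_eq_discr_and_span (hK : IsImaginaryQuadratic K) :
    ∃ δ : K, δ ^ 2 = algebraMap ℚ K (NumberField.discr K : ℚ) ∧ (∀ a : ℚ, algebraMap ℚ K a ≠ δ) ∧
      ∀ z : K, ∃ a b : ℚ, z = algebraMap ℚ K a + algebraMap ℚ K b * δ := by
  obtain ⟨-, -, δ₀, -, hδ₀⟩ :=
    Literature.NumberTheory.QuadraticFields.Quadratic.exists_sq_eq_discr (K := K) hK.1
  have hδ : ((δ₀ : K)) ^ 2 = algebraMap ℚ K (NumberField.discr K : ℚ) := by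
    have h := congrArg (algebraMap (NumberField.RingOfIntegers K) K) hδ₀
    rw [map_pow, map_intCast] at h
    rw [h, map_intCast]
  have hδK : ∀ a : ℚ, algebraMap ℚ K a ≠ (δ₀ : K) := by
    intro a ha
    have h2 : algebraMap ℚ K (a ^ 2) = algebraMap ℚ K (NumberField.discr K : ℚ) := by
      rw [map_pow, ha, hδ]
    have h3 : a ^ 2 = (NumberField.discr K : ℚ) := (algebraMap ℚ K).injective h2
    have h4 : ((NumberField.discr K : ℤ) : ℚ) < 0 := by exact_mod_cast hK.discr_neg
    nlinarith [sq_nonneg a]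
  exact ⟨δ₀, hδ, hδK, exists_eq_add_mul_of_finrank_eq_two hK.1 hδK⟩

/-- In `K` imaginary quadratic: a rational `c` that is a square in `K` is a square in `ℚ` or `c·d_K`
is. [folklore] -/
theorem isSquare_or_of_isSquare_algebraMap_rat (hK : IsImaginaryQuadratic K) {c : ℚ}
    (hc : IsSquare (algebraMap ℚ K c)) : IsSquare c ∨ IsSquare (c * (NumberField.discr K : ℚ)) := by
  obtain ⟨δ, hδ, hδK, hspan⟩ := exists_sq_eq_discr_and_span hK
  exact isSquare_or_isSquare_mul_of_isSquare_algebraMap two_ne_zero hδ hδK hspan hc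

/-- In a quadratic extension `H₀ = K(i₀)`, `i₀² = −1`, of an imaginary quadratic `K` with
`d_K = −4q`, `q` prime: `i₀ ∉ K` (as `−1` is not a square in `K`: neither `−1` nor `4q` is a rational
square) and an element `c ∈ K` that is a square in `H₀` is a square in `K` or `−c` is. [folklore] -/
theorem isSquare_or_of_isSquare_algebraMap_genusField (hK : IsImaginaryQuadratic K) {q : ℕ}
    (hq : q.Prime) (hdK : NumberField.discr K = -(4 * (q : ℤ)))
    {H₀ : Type*} [Field H₀] [Algebra K H₀] (hH : Module.finrank K H₀ = 2) {i₀ : H₀}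
    (hi : i₀ ^ 2 = -1) {c : K} (hc : IsSquare (algebraMap K H₀ c)) : IsSquare c ∨ IsSquare (-c) := by
  have hiK : ∀ a : K, algebraMap K H₀ a ≠ i₀ := by
    intro a ha
    have h1 : IsSquare (algebraMap ℚ K (-1)) := by
      refine ⟨a, ?_⟩
      apply (algebraMap K H₀).injective
      rw [map_mul, ha, ← pow_two, hi, map_neg, map_one, map_neg, map_one]
    rcases isSquare_or_of_isSquare_algebraMap_rat hK h1 with h | h
    · exact not_isSquare_of_neg (by norm_num) h
    · rw [hdK] at h
      push_cast at h
      have h' : IsSquare (q : ℚ) := isSquare_of_isSquare_four_mul (by convert h using 1; ring)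
      exact not_isSquare_prime hq (Rat.isSquare_natCast_iff.mp h')
  have hi' : i₀ ^ 2 = algebraMap K H₀ (-1) := by rw [hi, map_neg, map_one]
  have h2 : (2 : K) ≠ 0 := two_ne_zero
  rcases isSquare_or_isSquare_mul_of_isSquare_algebraMap h2 hi' hiK
      (exists_eq_add_mul_of_finrank_eq_two hH hiK) hc with h | h
  · exact Or.inl h
  · exact Or.inr (by simpa using h)

/-- **The four non-squares of the genus descent**: in `H₀ = K(i)`, `K = ℚ(√−q)` (`d_K = −4q`, `q` prime,
`q ≠ 2, 7`), none of `−7, 7, −2, −14` is a square (reduce to `K` by `isSquare_or_of_isSquare_algebraMap_genusField`,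
then to `ℚ` by `isSquare_or_of_isSquare_algebraMap_rat`, then `not_isSquare_genusConstants`). [folklore] -/
theorem not_isSquare_genusField (hK : IsImaginaryQuadratic K) {q : ℕ} (hq : q.Prime) (hq2 : q ≠ 2)
    (hq7 : q ≠ 7) (hdK : NumberField.discr K = -(4 * (q : ℤ)))
    {H₀ : Type*} [Field H₀] [Algebra K H₀] (hH : Module.finrank K H₀ = 2) {i₀ : H₀} (hi : i₀ ^ 2 = -1) :
    ¬ IsSquare (-7 : H₀) ∧ ¬ IsSquare (7 : H₀) ∧ ¬ IsSquare (-2 : H₀) ∧ ¬ IsSquare (-14 : H₀) := by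
  obtain ⟨⟨a1, a2⟩, ⟨b1, b2⟩, ⟨c1, c2⟩, ⟨d1, d2⟩, ⟨e1, e2⟩, ⟨f1, f2⟩⟩ := not_isSquare_genusConstants hq hq2 hq7
  have hdQ : ((NumberField.discr K : ℤ) : ℚ) = -(4 * (q : ℚ)) := by rw [hdK]; push_cast; ring
  -- reduction of a rational constant from `H₀` to `ℚ`
  have red : ∀ c : ℚ, IsSquare (algebraMap K H₀ (algebraMap ℚ K c)) →
      (IsSquare c ∨ IsSquare (c * -(4 * (q : ℚ)))) ∨ (IsSquare (-c) ∨ IsSquare (-c * -(4 * (q : ℚ)))) := by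
    intro c hc
    rcases isSquare_or_of_isSquare_algebraMap_genusField hK hq hdK hH hi hc with h | h
    · left; rw [← hdQ]; exact isSquare_or_of_isSquare_algebraMap_rat hK h
    · right; rw [← hdQ]
      exact isSquare_or_of_isSquare_algebraMap_rat hK (by rw [map_neg]; exact h)
  have cast : ∀ c : ℚ, algebraMap K H₀ (algebraMap ℚ K c) = (c : H₀) := fun c => by
    rw [eq_ratCast, map_ratCast]
  refine ⟨fun h => ?_, fun h => ?_, fun h => ?_, fun h => ?_⟩
  · rcases red (-7) (by rw [cast]; push_cast; exact h) with (h' | h') | (h' | h')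
    · exact a1 h'
    · exact a2 h'
    · exact b1 (by ring_nf at h' ⊢; exact h')
    · exact b2 (by ring_nf at h' ⊢; exact h')
  · rcases red 7 (by rw [cast]; push_cast; exact h) with (h' | h') | (h' | h')
    · exact b1 h'
    · exact b2 h'
    · exact a1 (by ring_nf at h' ⊢; exact h')
    · exact a2 (by ring_nf at h' ⊢; exact h')
  · rcases red (-2) (by rw [cast]; push_cast; exact h) with (h' | h') | (h' | h')
    · exact c1 h'
    · exact c2 h'
    · exact d1 (by ring_nf at h' ⊢; exact h')
    · exact d2 (by ring_nf at h' ⊢; exact h')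
  · rcases red (-14) (by rw [cast]; push_cast; exact h) with (h' | h') | (h' | h')
    · exact e1 h'
    · exact e2 h'
    · exact f1 (by ring_nf at h' ⊢; exact h')
    · exact f2 (by ring_nf at h' ⊢; exact h')

end GenusField

end Summit.BirchSwinnertonDyer.BirchSwinnertonDyer.Theorems.GoldfeldGoodTwists

end
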